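import Literature.NumberTheory.LFunctions.WeilSemilocalQuadratic
import Literature.NumberTheory.LFunctions.WeilWindowSuzukiContinuityProofs
import Literature.NumberTheory.LFunctions.WeilOddGroundState
import Literature.NumberTheory.LFunctions.WeilGroundEnergyProofs
import Literature.NumberTheory.LFunctions.WeilMellinInversion
import Literature.Analysis.SpecialFunctions.DigammaReflection
import HarnessLib

/-!
# The `{∞, 2}` semi-local Weil form is not positive on large cones

Trunk T-ZEROFREE / explicit-formula side (`Literature/NumberTheory/LFunctions`), sequel of
`WeilSemilocalQuadratic.lean` (the semi-local functional `W_S`, `WeilSemilocalPositivityOn S a`).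

There it is proved that `W_{∞,2}` is positive on the cone `C(563/1024)` (it coincides with the full Weil
form up to `(log 3)/2` and with `E₂` up to `log 2`). Here the complementary, negative statement:

* `exists_not_weilSemilocalPositivityOn_two` — **there is `a > 0` with `¬ WeilSemilocalPositivityOn {2} a`**,
  hence (monotonicity) `W_{∞,2}(g ⋆ g̃) < 0` for some test function on every larger cone.

So "positivity of the semi-local Weil functional at `S = {∞, 2}`" is not a statement: unlike the full
functional (whose positivity on every cone is equivalent to RH, `weil_criterion`), the `{∞,2}` functional
changes sign at a finite support. (Numerically the bottom of the odd sector changes sign at `a ≈ 0.558`;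
this file proves only the qualitative statement, with an inexplicit `a`.)

## Proof

Connes' semi-local functional (Connes 1999, §VII Thm 4) at `S = {2}` is
`W_{∞,2}(k) = k̂(0) + k̂(1) − Σ_{m ≥ 1} (log 2) 2^{−m/2} (k(m log 2) + k(−m log 2)) + W_∞(k)`. Take an ODD
test function `g₁` with `∫|g₁|² = 1` (`exists_isWeilTest_odd_sphere`) and its unitary dilates
`g_c = weilDilate (c − 1) g₁` (`c > 0` small; Bombieri's `f_ε`, `WeilDilationVirial.lean`), whose
autocorrelation is `k_c = k₁(c ·)`, `k₁ = g₁ ⋆ g̃₁` (`weilConv_weilDilate_weilReflect`). Then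
* polar term: `g_c` is odd, so `ĝ_c(1) = −ĝ_c(0)` and `k̂_c(0) + k̂_c(1) = −2|ĝ_c(0)|² ≤ 0`;
* prime term: `|k_c| ≤ ∫|g_c|² = 1` (Cauchy–Schwarz, `norm_weilConv_weilReflect_le`), so it is bounded by
  `2 Σ_n Λ_{{2}}(n) n^{-1/2} ≤ 2 log 2 Σ_{m ≥ 0} 2^{-m/2} = 2 log 2 / (1 − 2^{-1/2}) < 4.734`;
* archimedean term: `W_∞(k_c) = (1/2π) ∫ |ĝ₁(1/2+iu)|² Re ψ(1/4 + icu/2) du − log π`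
  (`weilArchIntegral_comp_mul_weilConv_weilReflect`), and `Re ψ(1/4+icu/2) ≤ ψ(1/4) + 27 c² u²`
  (`reDigammaQuarter_sub_le`), so `W_∞(k_c) ≤ ψ(1/4) − log π + (27 c²/2π) ∫ u² |ĝ₁(1/2+iu)|² du`.
With Gauss' `ψ(1/4) = −γ − π/2 − 3 log 2 < −4.149` and `log π > 1` the constant part is `< −0.415`, and the
last term is `< 1/(2π)` once `c² (1 + 27 ∫ u²|ĝ₁|²) ≤ 1`. Hence `Re W_{∞,2}(g_c ⋆ g̃_c) < 0` while
`supp g_c ⊆ [−1/c, 1/c]`.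

## References

* A. Connes, *Trace formula in noncommutative geometry and the zeros of the Riemann zeta function*,
  Selecta Math. 5 (1999), §VII Thm 4 (the S-local trace formula / S-local Weil distribution).
* E. Bombieri, *Remarks on Weil's quadratic functional in the theory of prime numbers, I*,
  Rend. Mat. Acc. Lincei (9) 11 (2000), §4 (the dilation `f_ε`).
-/

noncomputable section

open Complex MeasureTheory Set Filter Topology
open scoped Real ComplexConjugate

namespace Literature.NumberTheory.LFunctions

open Literature.Analysis.SpecialFunctions

variable {g : ℝ → ℂ}

/-! ## The dyadic mass `Σ_n Λ_{{2}}(n) n^{-1/2}` -/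

/-- The semi-local coefficients are non-negative. [folklore] -/
theorem weilSemilocalCoeff_nonneg (S : Finset ℕ) (n : ℕ) : 0 ≤ weilSemilocalCoeff S n := by
  unfold weilSemilocalCoeff
  split_ifs
  · exact div_nonneg ArithmeticFunction.vonMangoldt_nonneg (Real.sqrt_nonneg _)
  · exact le_rfl

/-- A non-zero `{2}`-coefficient sits at a power of `2`. [folklore] -/
theorem exists_eq_two_pow_of_weilSemilocalCoeff_two_ne_zero {n : ℕ} (h : weilSemilocalCoeff {2} n ≠ 0) :
    ∃ m : ℕ, n = 2 ^ m := by
  unfold weilSemilocalCoeff at h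
  split_ifs at h with hsub
  · have hΛ : (ArithmeticFunction.vonMangoldt n : ℝ) ≠ 0 := by
      intro h0; exact h (by rw [h0, zero_div])
    have hpp : IsPrimePow n := by
      by_contra hnp
      exact hΛ (ArithmeticFunction.vonMangoldt_eq_zero_iff.2 hnp)
    obtain ⟨p, m, hp, hm, rfl⟩ := (isPrimePow_nat_iff n).1 hpp
    have hpf : (p ^ m).primeFactors = {p} := Nat.primeFactors_prime_pow hm.ne' hp
    have hp2 : p ∈ ({2} : Finset ℕ) := hsub (by rw [hpf]; exact Finset.mem_singleton_self p)
    rw [Finset.mem_singleton] at hp2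
    exact ⟨m, by rw [hp2]⟩
  · exact absurd rfl h

/-- `√(2^m) = (√2)^m`. [folklore] -/
theorem sqrt_two_pow (m : ℕ) : Real.sqrt ((2 : ℕ) ^ m : ℕ) = Real.sqrt 2 ^ m := by
  have h : (((2 : ℕ) ^ m : ℕ) : ℝ) = (Real.sqrt 2 ^ m) ^ 2 := by
    rw [← pow_mul, mul_comm, pow_mul, Real.sq_sqrt (by norm_num : (0 : ℝ) ≤ 2)]
    push_cast
    rfl
  rw [h, Real.sqrt_sq (by positivity)]

/-- Termwise bound at the powers of two: `Λ_{{2}}(2^m) 2^{-m/2} ≤ log 2 · (1/√2)^m` (equality for `m ≥ 1`,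
the left side is `0` at `m = 0`). [folklore] -/
theorem weilSemilocalCoeff_two_pow_le (m : ℕ) :
    weilSemilocalCoeff {2} (2 ^ m) ≤ Real.log 2 * (Real.sqrt 2)⁻¹ ^ m := by
  rcases eq_or_ne m 0 with rfl | hm
  · rw [pow_zero, weilSemilocalCoeff_two_one, pow_zero, mul_one]
    exact Real.log_nonneg (by norm_num)
  · rw [weilSemilocalCoeff_two_pow hm, sqrt_two_pow, inv_pow, div_eq_mul_inv]

/-- **The `{2}`-coefficients are summable** (a geometric series along the powers of `2`). [folklore] -/
theorem summable_weilSemilocalCoeff_two : Summable (weilSemilocalCoeff {2}) := by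
  have hinj : Function.Injective (fun m : ℕ ↦ 2 ^ m) := Nat.pow_right_injective (le_refl 2)
  have hout : ∀ n ∉ Set.range (fun m : ℕ ↦ 2 ^ m), weilSemilocalCoeff {2} n = 0 := by
    intro n hn
    by_contra h
    obtain ⟨m, rfl⟩ := exists_eq_two_pow_of_weilSemilocalCoeff_two_ne_zero h
    exact hn ⟨m, rfl⟩
  refine (hinj.summable_iff hout).1 ?_
  have hr1 : (Real.sqrt 2)⁻¹ < 1 := inv_lt_one_of_one_lt₀ (by
    rw [show (1 : ℝ) = Real.sqrt 1 by simp]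
    exact Real.sqrt_lt_sqrt (by norm_num) (by norm_num))
  have hgeo := summable_geometric_of_lt_one (inv_nonneg.2 (Real.sqrt_nonneg 2)) hr1
  exact Summable.of_nonneg_of_le (fun m ↦ weilSemilocalCoeff_nonneg _ _)
    (fun m ↦ weilSemilocalCoeff_two_pow_le m) (hgeo.mul_left _)

/-- **The dyadic mass**: `Σ_n Λ_{{2}}(n) n^{-1/2} ≤ log 2 / (1 − 1/√2)` (in fact `= log 2/(√2 − 1)`). [folklore] -/
theorem tsum_weilSemilocalCoeff_two_le :
    ∑' n : ℕ, weilSemilocalCoeff {2} n ≤ Real.log 2 * (1 - (Real.sqrt 2)⁻¹)⁻¹ := by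
  have hinj : Function.Injective (fun m : ℕ ↦ 2 ^ m) := Nat.pow_right_injective (le_refl 2)
  have hsupp : Function.support (weilSemilocalCoeff {2}) ⊆ Set.range (fun m : ℕ ↦ 2 ^ m) := by
    intro n hn
    obtain ⟨m, rfl⟩ := exists_eq_two_pow_of_weilSemilocalCoeff_two_ne_zero (Function.mem_support.1 hn)
    exact ⟨m, rfl⟩
  have hout : ∀ n ∉ Set.range (fun m : ℕ ↦ 2 ^ m), weilSemilocalCoeff {2} n = 0 := by
    intro n hn
    by_contra h
    obtain ⟨m, rfl⟩ := exists_eq_two_pow_of_weilSemilocalCoeff_two_ne_zero h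
    exact hn ⟨m, rfl⟩
  have hr1 : (Real.sqrt 2)⁻¹ < 1 := inv_lt_one_of_one_lt₀ (by
    rw [show (1 : ℝ) = Real.sqrt 1 by simp]
    exact Real.sqrt_lt_sqrt (by norm_num) (by norm_num))
  have hgeo := summable_geometric_of_lt_one (inv_nonneg.2 (Real.sqrt_nonneg 2)) hr1
  have h1 : ∑' m : ℕ, weilSemilocalCoeff {2} (2 ^ m) = ∑' n : ℕ, weilSemilocalCoeff {2} n :=
    hinj.tsum_eq (f := weilSemilocalCoeff {2}) hsupp
  have h2 : Summable fun m : ℕ ↦ weilSemilocalCoeff {2} (2 ^ m) :=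
    (hinj.summable_iff (f := weilSemilocalCoeff {2}) hout).2 summable_weilSemilocalCoeff_two
  have h3 : ∑' m : ℕ, weilSemilocalCoeff {2} (2 ^ m) ≤ ∑' m : ℕ, Real.log 2 * (Real.sqrt 2)⁻¹ ^ m :=
    Summable.tsum_le_tsum (fun m ↦ weilSemilocalCoeff_two_pow_le m) h2 (hgeo.mul_left _)
  have h4 : ∑' m : ℕ, Real.log 2 * (Real.sqrt 2)⁻¹ ^ m = Real.log 2 * (1 - (Real.sqrt 2)⁻¹)⁻¹ := by
    rw [tsum_mul_left, tsum_geometric_of_lt_one (inv_nonneg.2 (Real.sqrt_nonneg 2)) hr1]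
  rw [← h1]
  exact h3.trans h4.le

/-- Numerical value: `log 2 / (1 − 1/√2) ≤ 2.367`. [folklore] -/
theorem dyadicMass_le : Real.log 2 * (1 - (Real.sqrt 2)⁻¹)⁻¹ ≤ 2.367 := by
  have h2 : (1.4142 : ℝ) ≤ Real.sqrt 2 := Real.le_sqrt_of_sq_le (by norm_num)
  have hinv : (Real.sqrt 2)⁻¹ ≤ 1 / 1.4142 := by
    rw [one_div]; exact inv_anti₀ (by norm_num) h2
  have hden : (0.2928 : ℝ) ≤ 1 - (Real.sqrt 2)⁻¹ := by
    have : (1 : ℝ) / 1.4142 ≤ 0.7072 := by norm_num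
    linarith
  have hlog := Real.log_two_lt_d9
  rw [← div_eq_mul_inv, div_le_iff₀ (by linarith)]
  nlinarith

/-- **Bound for the `{2}`-prime term** of a bounded kernel: `|Σ_n Λ_{{2}}(n) n^{-1/2} (k(log n) + k(−log n))|
≤ 2K · Σ_n Λ_{{2}}(n) n^{-1/2}` if `|k| ≤ K`. [folklore] -/
theorem norm_weilSemilocalPrimeTerm_two_le {k : ℝ → ℂ} {K : ℝ} (hK : ∀ x, ‖k x‖ ≤ K) :
    ‖weilSemilocalPrimeTerm {2} k‖ ≤ 2 * K * (Real.log 2 * (1 - (Real.sqrt 2)⁻¹)⁻¹) := by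
  have hK0 : 0 ≤ K := (norm_nonneg _).trans (hK 0)
  set f : ℕ → ℂ := fun n ↦ (weilSemilocalCoeff {2} n : ℂ) * (k (Real.log n) + k (-Real.log n)) with hf
  have hbound : ∀ n, ‖f n‖ ≤ weilSemilocalCoeff {2} n * (2 * K) := by
    intro n
    rw [hf, norm_mul, Complex.norm_real, Real.norm_of_nonneg (weilSemilocalCoeff_nonneg _ _)]
    refine mul_le_mul_of_nonneg_left ?_ (weilSemilocalCoeff_nonneg _ _)
    calc ‖k (Real.log n) + k (-Real.log n)‖ ≤ ‖k (Real.log n)‖ + ‖k (-Real.log n)‖ := norm_add_le _ _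
      _ ≤ K + K := add_le_add (hK _) (hK _)
      _ = 2 * K := by ring
  have hsum : Summable fun n ↦ weilSemilocalCoeff {2} n * (2 * K) :=
    summable_weilSemilocalCoeff_two.mul_right _
  have hnorm : Summable fun n ↦ ‖f n‖ :=
    Summable.of_nonneg_of_le (fun n ↦ norm_nonneg _) hbound hsum
  unfold weilSemilocalPrimeTerm
  calc ‖∑' n, f n‖ ≤ ∑' n, ‖f n‖ := norm_tsum_le_tsum_norm hnorm
    _ ≤ ∑' n, weilSemilocalCoeff {2} n * (2 * K) := hnorm.tsum_le_tsum hbound hsum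
    _ = (∑' n, weilSemilocalCoeff {2} n) * (2 * K) := tsum_mul_right
    _ ≤ Real.log 2 * (1 - (Real.sqrt 2)⁻¹)⁻¹ * (2 * K) :=
        mul_le_mul_of_nonneg_right tsum_weilSemilocalCoeff_two_le (by positivity)
    _ = 2 * K * (Real.log 2 * (1 - (Real.sqrt 2)⁻¹)⁻¹) := by ring

/-! ## Odd test functions: the polar term is `≤ 0` -/

/-- For an odd `g`, `ĝ(1) = −ĝ(0)`. [folklore] -/
theorem weilMellin_one_eq_neg_of_odd (hodd : ∀ t, g (-t) = -g t) : weilMellin g 1 = -weilMellin g 0 := by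
  have e : (fun t ↦ g (-t)) = fun t ↦ (-1 : ℂ) * g t := funext fun t ↦ by rw [hodd]; ring
  calc weilMellin g 1 = weilMellin g (1 - 0) := by norm_num
    _ = weilMellin (fun t ↦ g (-t)) 0 := (weilMellin_comp_neg g 0).symm
    _ = -weilMellin g 0 := by rw [e, weilMellin_const_mul]; ring

/-- **For an odd test function the polar term is `−2|ĝ(0)|² ≤ 0`.** [folklore] -/
theorem re_weilPolarTerm_weilConv_weilReflect_of_odd (hg : IsWeilTest g) (hodd : ∀ t, g (-t) = -g t) :
    (weilPolarTerm (weilConv g (weilReflect g))).re = -(2 * ‖weilMellin g 0‖ ^ 2) := by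
  rw [weilPolarTerm_weilConv_weilReflect hg, Complex.ofReal_re, weilMellin_one_eq_neg_of_odd hodd,
    map_neg, mul_neg, Complex.neg_re, Complex.mul_conj, Complex.ofReal_re, Complex.normSq_eq_norm_sq]
  ring

/-- Dilates of odd functions are odd. [folklore] -/
theorem weilDilate_odd (hodd : ∀ t, g (-t) = -g t) (η : ℝ) (t : ℝ) :
    weilDilate η g (-t) = -weilDilate η g t := by
  simp only [weilDilate_apply, mul_neg, hodd, mul_neg]

/-! ## The archimedean term of a dilate -/

/-- **Archimedean term of a dilate, bounded above**: for a test function `g` with `∫|g|² = 1`, `c > 0` and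
`k_c = (g ⋆ g̃)(c ·)`,
`Re W_∞(k_c) ≤ ψ(1/4) − log π + (27 c² / 2π) ∫ u² |ĝ(1/2+iu)|² du`. [folklore] -/
theorem re_weilArchTerm_comp_mul_le (hg : IsWeilTest g) (hn : ∫ t, ‖g t‖ ^ 2 = (1 : ℝ)) {c : ℝ} (hc : 0 < c) :
    (weilArchTerm (fun t ↦ weilConv g (weilReflect g) (c * t))).re ≤
      reDigammaQuarter 0 - Real.log π +
        27 * c ^ 2 / (2 * π) * ∫ u : ℝ, ‖weilMellin g (1 / 2 + u * I)‖ ^ 2 * u ^ 2 := by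
  set D : ℝ := ∫ u : ℝ, ‖weilMellin g (1 / 2 + u * I)‖ ^ 2 * u ^ 2 with hD
  set Ic : ℝ := ∫ u : ℝ, ‖weilMellin g (1 / 2 + u * I)‖ ^ 2 * reDigammaQuarter (c * u) with hIc
  have hk0 : (fun t ↦ weilConv g (weilReflect g) (c * t)) 0 = 1 := by
    simp only [mul_zero, weilConv_weilReflect_apply_zero, hn, Complex.ofReal_one]
  have harch : weilArchTerm (fun t ↦ weilConv g (weilReflect g) (c * t)) =
      ((1 / (2 * π) * Ic - Real.log π : ℝ) : ℂ) := by
    unfold weilArchTerm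
    rw [weilArchIntegral_comp_mul_weilConv_weilReflect hg hc, hk0]
    push_cast
    ring
  rw [harch, Complex.ofReal_re]
  -- bound the integral
  have hint1 : Integrable fun u : ℝ ↦ ‖weilMellin g (1 / 2 + u * I)‖ ^ 2 * reDigammaQuarter (c * u) :=
    integrable_norm_sq_weilMellin_mul_reDigammaQuarter_comp_mul hg c
  have hint2 : Integrable fun u : ℝ ↦
      ‖weilMellin g (1 / 2 + u * I)‖ ^ 2 * (reDigammaQuarter 0 + 27 * c ^ 2 * u ^ 2) := by
    refine integrable_norm_sq_weilMellin_mul hg (by fun_prop) (A := |reDigammaQuarter 0|)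
      (B := 27 * c ^ 2) (abs_nonneg _) (by positivity) fun u ↦ ?_
    calc |reDigammaQuarter 0 + 27 * c ^ 2 * u ^ 2| ≤ |reDigammaQuarter 0| + |27 * c ^ 2 * u ^ 2| :=
          abs_add_le _ _
      _ = |reDigammaQuarter 0| + 27 * c ^ 2 * u ^ 2 := by
          rw [abs_of_nonneg (by positivity : (0 : ℝ) ≤ 27 * c ^ 2 * u ^ 2)]
  have hmono : Ic ≤ ∫ u : ℝ, ‖weilMellin g (1 / 2 + u * I)‖ ^ 2 * (reDigammaQuarter 0 + 27 * c ^ 2 * u ^ 2) := by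
    refine integral_mono hint1 hint2 fun u ↦ ?_
    refine mul_le_mul_of_nonneg_left ?_ (by positivity)
    have h := reDigammaQuarter_sub_le (c * u)
    nlinarith [h]
  have hsplit : (∫ u : ℝ, ‖weilMellin g (1 / 2 + u * I)‖ ^ 2 * (reDigammaQuarter 0 + 27 * c ^ 2 * u ^ 2)) =
      reDigammaQuarter 0 * (2 * π) + 27 * c ^ 2 * D := by
    have hi1 : Integrable fun u : ℝ ↦ ‖weilMellin g (1 / 2 + u * I)‖ ^ 2 * reDigammaQuarter 0 :=
      (integrable_norm_sq_weilMellin_half_line hg).mul_const _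
    have hi2 : Integrable fun u : ℝ ↦ ‖weilMellin g (1 / 2 + u * I)‖ ^ 2 * u ^ 2 :=
      integrable_norm_sq_weilMellin_mul hg (by fun_prop) (A := 0) (B := 1) le_rfl zero_le_one
        fun u ↦ by rw [abs_of_nonneg (sq_nonneg u)]; linarith
    have e : (fun u : ℝ ↦ ‖weilMellin g (1 / 2 + u * I)‖ ^ 2 * (reDigammaQuarter 0 + 27 * c ^ 2 * u ^ 2)) =
        fun u : ℝ ↦ ‖weilMellin g (1 / 2 + u * I)‖ ^ 2 * reDigammaQuarter 0 +
          27 * c ^ 2 * (‖weilMellin g (1 / 2 + u * I)‖ ^ 2 * u ^ 2) := by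
      funext u; ring
    rw [e, integral_add hi1 (hi2.const_mul _), integral_mul_const, integral_const_mul,
      integral_norm_sq_weilMellin_half_line hg]
    unfold weilNorm2Sq
    rw [hn]
    ring
  have hπ : (0 : ℝ) < 2 * π := by positivity
  calc 1 / (2 * π) * Ic - Real.log π ≤ 1 / (2 * π) * (reDigammaQuarter 0 * (2 * π) + 27 * c ^ 2 * D) - Real.log π := by
        gcongr
        exact hmono.trans hsplit.le
    _ = reDigammaQuarter 0 - Real.log π + 27 * c ^ 2 / (2 * π) * D := by
        field_simp
        ring

/-! ## Numerical constants -/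

/-- `ψ(1/4) < −4.149` (Gauss: `ψ(1/4) = −γ − π/2 − 3 log 2`, with `γ > 1/2`, `π > 3.14`, `log 2 > 0.6931471803`). [folklore] -/
theorem reDigammaQuarter_zero_lt_neg : reDigammaQuarter 0 < -4.149 := by
  rw [reDigammaQuarter_zero, Literature.Analysis.SpecialFunctions.Complex.digamma_one_quarter_eq_neg_ofReal,
    Complex.neg_re, Complex.ofReal_re]
  have h1 := Real.one_half_lt_eulerMascheroniConstant
  have h2 := Real.pi_gt_d2
  have h3 := Real.log_two_gt_d9
  linarith

/-- `1 < log π` (`e < 3 < π`). [folklore] -/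
theorem one_lt_log_pi : 1 < Real.log π := by
  rw [Real.lt_log_iff_exp_lt Real.pi_pos]
  have h1 := Real.exp_one_lt_d9
  have h2 := Real.pi_gt_three
  linarith

/-! ## The negative rung -/

/-- **The `{∞,2}` semi-local Weil form is negative somewhere**: there are `a > 0` and a test function `g` with
`supp g ⊆ [-a, a]` and `Re W_{∞,2}(g ⋆ g̃) < 0`. [folklore] -/
theorem exists_re_weilSemilocalQuadratic_two_neg :
    ∃ a : ℝ, 0 < a ∧ ∃ g : ℝ → ℂ, IsWeilTest g ∧ tsupport g ⊆ Icc (-a) a ∧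
      (weilSemilocalQuadratic {2} g).re < 0 := by
  obtain ⟨g₁, hg₁, hsupp₁, hodd₁, hn₁⟩ := exists_isWeilTest_odd_sphere zero_lt_one
  set D : ℝ := ∫ u : ℝ, ‖weilMellin g₁ (1 / 2 + u * I)‖ ^ 2 * u ^ 2 with hD
  have hD0 : 0 ≤ D := integral_nonneg fun u ↦ by positivity
  -- the dilation parameter: c² (1 + 27 D) = 1
  set c : ℝ := (Real.sqrt (1 + 27 * D))⁻¹ with hc
  have hR : 0 < Real.sqrt (1 + 27 * D) := Real.sqrt_pos.2 (by positivity)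
  have hc0 : 0 < c := inv_pos.2 hR
  have hc2 : c ^ 2 * (1 + 27 * D) = 1 := by
    rw [hc, inv_pow, Real.sq_sqrt (by positivity), inv_mul_cancel₀ (by positivity)]
  set η : ℝ := c - 1 with hη
  have hη1 : -1 < η := by rw [hη]; linarith
  have hcη : 1 + η = c := by rw [hη]; ring
  set gc : ℝ → ℂ := weilDilate η g₁ with hgc
  have hgct : IsWeilTest gc := hg₁.weilDilate hη1
  have hgcodd : ∀ t, gc (-t) = -gc t := weilDilate_odd hodd₁ η
  have hgcn : ∫ t, ‖gc t‖ ^ 2 = (1 : ℝ) := by rw [hgc, integral_norm_sq_weilDilate g₁ hη1, hn₁]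
  have hgcsupp : tsupport gc ⊆ Icc (-(1 / c)) (1 / c) := by
    have h := tsupport_weilDilate_subset g₁ hη1 hsupp₁
    rwa [hcη] at h
  refine ⟨1 / c, by positivity, gc, hgct, hgcsupp, ?_⟩
  -- the kernel of the dilate is the rescaled kernel
  have hk : weilConv gc (weilReflect gc) = fun t ↦ weilConv g₁ (weilReflect g₁) (c * t) := by
    rw [hgc, weilConv_weilDilate_weilReflect g₁ hη1, hcη]
  -- decomposition of Re Q_S
  have hQ : (weilSemilocalQuadratic {2} gc).re =
      (weilPolarTerm (weilConv gc (weilReflect gc))).re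
        - (weilSemilocalPrimeTerm {2} (weilConv gc (weilReflect gc))).re
        + (weilArchTerm (weilConv gc (weilReflect gc))).re := by
    unfold weilSemilocalQuadratic weilSemilocalFunctional
    simp only [Complex.add_re, Complex.sub_re]
  -- polar ≤ 0
  have hpol : (weilPolarTerm (weilConv gc (weilReflect gc))).re ≤ 0 := by
    rw [re_weilPolarTerm_weilConv_weilReflect_of_odd hgct hgcodd]
    have := sq_nonneg ‖weilMellin gc 0‖
    linarith
  -- prime term bounded by 2 · dyadic mass
  have hK : ∀ x, ‖weilConv gc (weilReflect gc) x‖ ≤ 1 := fun x ↦ by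
    have h := norm_weilConv_weilReflect_le hgct x
    rwa [hgcn] at h
  have hpr : -(weilSemilocalPrimeTerm {2} (weilConv gc (weilReflect gc))).re ≤ 2 * 2.367 := by
    have h1 := norm_weilSemilocalPrimeTerm_two_le hK
    have h2 : -(weilSemilocalPrimeTerm {2} (weilConv gc (weilReflect gc))).re ≤
        ‖weilSemilocalPrimeTerm {2} (weilConv gc (weilReflect gc))‖ := by
      have := Complex.abs_re_le_norm (weilSemilocalPrimeTerm {2} (weilConv gc (weilReflect gc)))
      rw [abs_le] at this
      linarith [this.1]
    have h3 := dyadicMass_le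
    have h4 : (0 : ℝ) ≤ Real.log 2 * (1 - (Real.sqrt 2)⁻¹)⁻¹ :=
      le_trans (tsum_nonneg fun n ↦ weilSemilocalCoeff_nonneg _ _) tsum_weilSemilocalCoeff_two_le
    nlinarith
  -- archimedean term
  have har : (weilArchTerm (weilConv gc (weilReflect gc))).re ≤
      reDigammaQuarter 0 - Real.log π + 27 * c ^ 2 / (2 * π) * D := by
    rw [hk]
    exact re_weilArchTerm_comp_mul_le hg₁ hn₁ hc0
  have hlast : 27 * c ^ 2 / (2 * π) * D ≤ 1 / 6 := by
    have hπ3 := Real.pi_gt_three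
    have hcD : 27 * c ^ 2 * D ≤ 1 := by nlinarith [hc2, sq_nonneg c]
    rw [div_mul_eq_mul_div, div_le_iff₀ (by positivity)]
    nlinarith
  have hψ := reDigammaQuarter_zero_lt_neg
  have hlπ := one_lt_log_pi
  rw [hQ]
  linarith

/-- **The negative rung of the `S`-ladder at `S = {∞, 2}`**: the semi-local Weil form is NOT positive on some
cone `C(a)`; by `WeilSemilocalPositivityOn.mono`, on no larger cone either. [folklore] -/
theorem exists_not_weilSemilocalPositivityOn_two : ∃ a : ℝ, 0 < a ∧ ¬ WeilSemilocalPositivityOn {2} a := by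
  obtain ⟨a, ha, g, hg, hsupp, hneg⟩ := exists_re_weilSemilocalQuadratic_two_neg
  exact ⟨a, ha, fun h ↦ absurd (h g hg hsupp) (not_le.2 hneg)⟩

/-- Eventual form: beyond some support, the `{∞,2}` semi-local form is never positive. [folklore] -/
theorem eventually_not_weilSemilocalPositivityOn_two :
    ∃ a : ℝ, 0 < a ∧ ∀ b, a ≤ b → ¬ WeilSemilocalPositivityOn {2} b := by
  obtain ⟨a, ha, hna⟩ := exists_not_weilSemilocalPositivityOn_two
  exact ⟨a, ha, fun b hab hb ↦ hna (hb.mono hab)⟩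

end Literature.NumberTheory.LFunctions
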